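import Mathlib
import HarnessLib
import Summits.NavierStokesRegularity.NavierStokesRegularity.Theorems.TaylorModelRungThreeDefs
import Summits.NavierStokesRegularity.NavierStokesRegularity.Theorems.TaylorModelRungThreeCertificateFormat
import Summits.NavierStokesRegularity.NavierStokesRegularity.Theorems.TaylorModelRungThreeCertificateSoundEntry
import Summits.NavierStokesRegularity.NavierStokesRegularity.Theorems.TaylorModelRungThreeCertificateScalar
import Summits.NavierStokesRegularity.NavierStokesRegularity.Theorems.TaylorModelRungThreeCertificateCompact
import Summits.NavierStokesRegularity.NavierStokesRegularity.Theorems.TaylorModelRungThreeCertificateReadoutsTrans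
import Summits.NavierStokesRegularity.NavierStokesRegularity.Theorems.TaylorModelRungThreeCertificateStageNumericsBilin
import Summits.NavierStokesRegularity.NavierStokesRegularity.Theorems.TaylorModelRungThreeCertificateStaticSlack

/-!
# Crux K1b-DR (stmt-NavierStokesRegularity-23954), line `taylor-model` — the CLOSER SHAPE of `stub_certificate`:
# `Valid` of the interpreted record from the Boolean checkers of the four blocks

Assembly of the four soundness lanes of CERT-CONTRACT-23954 (v1 format of record p602753 + v2 compact input):
`Static` (ns-tm-g4: `static_of_check`), `StageNumerics` (typer g31: `stageNumerics_of_check`), `Chain` (engine-1: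
`chain_of_checks`), `Readouts` (ns-tm-g4: `readouts_of_check`). `valid_of_checks` / `certificate_of_checks` turn a
tables record `T` over an exact ordered field with a monotone real embedding, its proof data (`StaticAux`, `ReadoutAux`,
`StageAux`, `EntryAux`) and the SEVEN replayed Booleans (`checkStatic`, `checkStageNumerics`, `checkChain`,
`checkPolyTails`, `checkEntry`, `checkReadouts`, and `CoefOK` — over `QS2 = ℚ(√2)` the Boolean `checkCoef`) into
`TaylorModel.TaylorModelChainCertificate`, the statement of `stub_certificate`; the compact (v2) specialisation goes
through `CertTablesC.expand`. What remains for the stub itself is ONE emitted certificate whose Booleans evaluate to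
`true`. MODEL-lattice rung TL-M3; nothing here is a statement about the Navier–Stokes equations.
-/

-- the sub-problem namespace repeats the summit name by design (D-0017)
set_option linter.dupNamespace false

namespace Summit.NavierStokesRegularity.NavierStokesRegularity.Theorems.TaylorModelCert

open Literature.Analysis.FluidPDE.TaoCascade Literature.Analysis.FluidPDE.TaoCascade.TaylorChain

namespace CertTables

section Generic

variable {K : Type} [Field K] [LinearOrder K] [IsStrictOrderedRing K] {φ : K →+* ℝ} (hφ : Monotone φ)
  (T : CertTables K)
include hφ

/-- **`Valid` from the checkers**: `Static`, `StageNumerics`, `Chain` (format checker + tails + entry certificate) and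
`Readouts` replayed as Booleans, under the coefficient hypothesis `CoefOK`. [folklore] -/
theorem valid_of_checks (A : ReadoutAux K) (B : StageAux K) (B'' : StaticAux K) (E : EntryAux K) (hco : T.CoefOK φ)
    (hS : T.checkStatic B'' = true) (hSN : T.checkStageNumerics A B = true) (hC : T.checkChain = true)
    (hTail : T.checkPolyTails = true) (hEn : T.checkEntry E = true) (hRO : T.checkReadouts A = true) :
    (T.toCertData φ).Valid :=
  have hSN' : (T.toCertData φ).StageNumerics := T.stageNumerics_of_check hφ A B hco hSN
  ⟨T.static_of_check hφ B'' hS, hSN', T.chain_of_checks hφ hco E hC hTail hEn, T.readouts_of_check hφ A hco hSN' hRO⟩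

/-- **The statement of `stub_certificate` from the checkers.** [folklore] -/
theorem certificate_of_checks (A : ReadoutAux K) (B : StageAux K) (B'' : StaticAux K) (E : EntryAux K)
    (hco : T.CoefOK φ) (hS : T.checkStatic B'' = true) (hSN : T.checkStageNumerics A B = true)
    (hC : T.checkChain = true) (hTail : T.checkPolyTails = true) (hEn : T.checkEntry E = true)
    (hRO : T.checkReadouts A = true) : TaylorModel.TaylorModelChainCertificate :=
  ⟨T.toCertData φ, T.valid_of_checks hφ A B B'' E hco hS hSN hC hTail hEn hRO⟩

end Generic

/-- **`ℚ(√2)` specialisation**: all seven hypotheses are `decide`/`native_decide`-able Booleans on the tables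
(`checkCoef` discharging `CoefOK` for the real embedding `QS2.toRealHom`). [folklore] -/
theorem certificate_of_QS2_checks (T : CertTables QS2) (A : ReadoutAux QS2) (B : StageAux QS2) (B'' : StaticAux QS2)
    (E : EntryAux QS2) (hcoef : T.checkCoef = true) (hS : T.checkStatic B'' = true)
    (hSN : T.checkStageNumerics A B = true) (hC : T.checkChain = true) (hTail : T.checkPolyTails = true)
    (hEn : T.checkEntry E = true) (hRO : T.checkReadouts A = true) : TaylorModel.TaylorModelChainCertificate :=
  T.certificate_of_checks QS2.toRealHom_monotone A B B'' E (T.coefOK_of_checkCoef hcoef) hS hSN hC hTail hEn hRO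

end CertTables

/-- **Compact (v2) specialisation**: the same for a compact record `C : CertTablesC QS2` through `C.expand`.
[folklore] -/
theorem CertTablesC.certificate_of_checks (C : CertTablesC QS2) (A : ReadoutAux QS2) (B : StageAux QS2)
    (B'' : StaticAux QS2) (E : EntryAux QS2) (hcoef : C.expand.checkCoef = true) (hS : C.expand.checkStatic B'' = true)
    (hSN : C.expand.checkStageNumerics A B = true) (hC : C.expand.checkChain = true)
    (hTail : C.expand.checkPolyTails = true) (hEn : C.expand.checkEntry E = true)
    (hRO : C.expand.checkReadouts A = true) : TaylorModel.TaylorModelChainCertificate :=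
  C.expand.certificate_of_QS2_checks A B B'' E hcoef hS hSN hC hTail hEn hRO

end Summit.NavierStokesRegularity.NavierStokesRegularity.Theorems.TaylorModelCert
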